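import Summits.PneNP.PneNP.Theorems.RamseyUncertifiableResolutionUncertaintyAdversary

/-!
# Heavy-block width for the unary clique CNF (LPRT Lemma 13 in unary) — crux stmt-PneNP-9816,
# line `box-dag-self-gadget-lifting`, first lemma toward the lever `stub_biDenseCoreHardness`

Continuation of `RamseyUncertifiableResolutionUncertaintyAdversary.lean`: the axioms of `cliqueCNF m k adj` admit no
adversary state, the backward resolution step (answer the pivot; fix a good vertex when an unfixed block is about to become
heavy), and the theorem `heavyBlockWidth`: on a graph `H` that is one-sidedly `δ`-dense (`0 < δ ≤ 1`) between all pairs of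
`M`-sets, with room `(k + 2^t + 2)·M ≤ δ^t·m/2`, every resolution refutation of `Clique(H, k)` contains a clause with at
least `t` heavy blocks. (`δ ≤ 1` is needed: with the density hypothesis vacuous, `M > m`, and `δ > 1` the room condition can
hold while no clause has `t` heavy blocks, e.g. `m=5, M=6, k=2, t=3, δ=4`.) [adaptation of Lauria–Pudlák–Rödl–Thapen,
arXiv:1303.3166, Lemma 13 and Cor. 12, to the unary encoding; folklore Prover–Adversary technique]
-/

-- `Summit.PneNP.PneNP.…` repeats `PneNP` by the tree's layout (summit = problem); silence the core linter as the landed siblings do.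
set_option linter.dupNamespace false

namespace Summit.PneNP.PneNP.Theorems.RamseyUncertifiableResolutionUncertainty

open Literature.Computability.Complexity Literature.Computability.MetaComplexity
open Summit.PneNP.PneNP.Theorems.RegularResolutionRung.Negative

section Clique

variable {m : ℕ} (H : SimpleGraph (Fin m)) [DecidableRel H.Adj] (k M : ℕ) (δ : ℚ)

/-- Block-variable numbering `(i, v) ↦ i * n + v` (`v < n`) is injective. -/
theorem blockVar_inj {n i j : ℕ} {u v : Fin n} (h : i * n + (u : ℕ) = j * n + (v : ℕ)) :
    i = j ∧ u = v := by
  have hu := u.isLt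
  have hv := v.isLt
  have hij : i = j := by
    rcases lt_trichotomy i j with hlt | heq | hgt
    · exfalso
      have : (i + 1) * n ≤ j * n := Nat.mul_le_mul_right n hlt
      nlinarith
    · exact heq
    · exfalso
      have : (j + 1) * n ≤ i * n := Nat.mul_le_mul_right n hgt
      nlinarith
  subst hij
  exact ⟨rfl, Fin.ext (by omega)⟩

/-! ## The axioms of `cliqueCNF` are unsafe -/

/-- The three clause families of `cliqueCNF`, read back as finsets. -/
theorem cliqueCNF_cases {n k : ℕ} {adj : Fin n → Fin n → Bool} {c : Clause ℕ} (hc : c ∈ cliqueCNF n k adj) :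
    (∃ i < k, ∀ v : Fin n, (i * n + (v : ℕ), true) ∈ c.toFinset) ∨
    (∃ i < k, ∃ u v : Fin n, u ≠ v ∧ c.toFinset = {(i * n + (u : ℕ), false), (i * n + (v : ℕ), false)}) ∨
    (∃ i < k, ∃ j < k, ∃ u v : Fin n, i ≠ j ∧ adj u v = false ∧
      c.toFinset = {(i * n + (u : ℕ), false), (j * n + (v : ℕ), false)}) := by
  simp only [cliqueCNF, List.mem_append] at hc
  rcases hc with (hc | hc) | hc
  · obtain ⟨i, hi, rfl⟩ := List.mem_map.1 hc
    refine Or.inl ⟨i, List.mem_range.1 hi, fun v => ?_⟩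
    rw [List.mem_toFinset]
    exact List.mem_map.2 ⟨(v : ℕ), by simp, rfl⟩
  · obtain ⟨i, hi, hc⟩ := List.mem_flatMap.1 hc
    have hi : i < k := List.mem_range.1 hi
    obtain ⟨u, hu, hc⟩ := List.mem_flatMap.1 hc
    obtain ⟨v, hv, hc⟩ := List.mem_flatMap.1 hc
    obtain ⟨u, rfl⟩ : ∃ a : Fin n, u = (a : ℕ) := by simpa using hu
    obtain ⟨v, rfl⟩ : ∃ a : Fin n, v = (a : ℕ) := by simpa using hv
    split_ifs at hc with huv
    · have hc : c = [(i * n + (u : ℕ), false), (i * n + (v : ℕ), false)] := List.mem_singleton.1 hc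
      subst hc
      refine Or.inr (Or.inl ⟨i, hi, u, v, fun h => ?_, by simp⟩)
      subst h
      exact lt_irrefl _ huv
    · simp at hc
  · obtain ⟨i, hi, hc⟩ := List.mem_flatMap.1 hc
    have hi : i < k := List.mem_range.1 hi
    obtain ⟨j, hj, hc⟩ := List.mem_flatMap.1 hc
    have hj : j < k := List.mem_range.1 hj
    obtain ⟨u, -, hc⟩ := List.mem_flatMap.1 hc
    obtain ⟨v, -, hc⟩ := List.mem_flatMap.1 hc
    split_ifs at hc with hcond
    · have hc : c = [(i * n + (u : ℕ), false), (j * n + (v : ℕ), false)] := List.mem_singleton.1 hc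
      subst hc
      exact Or.inr (Or.inr ⟨i, hi, j, hj, u, v, hcond.1, hcond.2, by simp⟩)
    · simp at hc

/-- No axiom of `Clique(H, k)` admits an adversary state (given `M ≤ m`, which the room condition implies). -/
theorem not_advInv_axiom {k M : ℕ} {δ : ℚ} (hMm : M ≤ m) {U : Finset (ℕ × Fin m)} {c : Clause ℕ}
    (hc : c ∈ cliqueCNF m k fun u v => decide (H.Adj u v)) (hU : AdvInv H k M δ U c.toFinset) : False := by
  obtain ⟨hcore, himg, hpos, hpin⟩ := hU
  rcases cliqueCNF_cases hc with ⟨i, hi, hall⟩ | ⟨i, hi, u, v, huv, hD⟩ | ⟨i, hi, j, hj, u, v, hij, hadj, hD⟩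
  · have hheavy : i ∈ heavyBlocks m k M c.toFinset := by
      rw [mem_heavyBlocks]
      refine ⟨hi, Or.inr ?_⟩
      have : (Finset.univ.filter fun v : Fin m => (i * m + v.val, true) ∈ c.toFinset) = Finset.univ := by
        ext v
        simp only [Finset.mem_filter, Finset.mem_univ, true_and, iff_true]
        exact hall v
      rw [this, Finset.card_univ, Fintype.card_fin]
      exact hMm
    rw [← himg] at hheavy
    obtain ⟨p, hp, hp1⟩ := Finset.mem_image.1 hheavy
    have := hall p.2
    rw [← hp1] at this
    exact hpos p hp this
  · have hheavy : i ∈ heavyBlocks m k M c.toFinset := by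
      rw [mem_heavyBlocks]
      exact ⟨hi, Or.inl ⟨u, by rw [hD]; simp⟩⟩
    rw [← himg] at hheavy
    obtain ⟨p, hp, hp1⟩ := Finset.mem_image.1 hheavy
    have hu : u = p.2 := hpin p hp u (by rw [hD, hp1]; simp)
    have hv : v = p.2 := hpin p hp v (by rw [hD, hp1]; simp)
    exact huv (hu.trans hv.symm)
  · have hhi : i ∈ heavyBlocks m k M c.toFinset := by
      rw [mem_heavyBlocks]
      exact ⟨hi, Or.inl ⟨u, by rw [hD]; simp⟩⟩
    have hhj : j ∈ heavyBlocks m k M c.toFinset := by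
      rw [mem_heavyBlocks]
      exact ⟨hj, Or.inl ⟨v, by rw [hD]; simp⟩⟩
    rw [← himg] at hhi hhj
    obtain ⟨p, hp, hp1⟩ := Finset.mem_image.1 hhi
    obtain ⟨q, hq, hq1⟩ := Finset.mem_image.1 hhj
    have hpq : p ≠ q := fun h => hij (by rw [← hp1, ← hq1, h])
    have hu : u = p.2 := hpin p hp u (by rw [hD, hp1]; simp)
    have hv : v = q.2 := hpin q hq v (by rw [hD, hq1]; simp)
    have hadj' := hcore.clique p hp q hq hpq
    rw [← hu, ← hv] at hadj'
    simp [hadj'] at hadj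

/-! ## The backward resolution step -/

/-- Heavy blocks of `C` are heavy in `E ⊇ C ∖ {l₀}` except possibly the block of `l₀`. -/
theorem heavyBlocks_subset_of_forall_mem {k M : ℕ} {C E : Finset (Literal ℕ)} {l₀ : Literal ℕ}
    (hsub : ∀ l ∈ C, l ≠ l₀ → l ∈ E) :
    heavyBlocks m k M C ⊆ heavyBlocks m k M E ∪
      (Finset.range k).filter fun i => ∃ v : Fin m, l₀.1 = i * m + v.val := by
  intro i hi
  rw [Finset.mem_union, Finset.mem_filter, Finset.mem_range]
  rw [mem_heavyBlocks] at hi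
  obtain ⟨hik, hi⟩ := hi
  by_cases hblk : ∃ v : Fin m, l₀.1 = i * m + v.val
  · exact Or.inr ⟨hik, hblk⟩
  · left
    rw [mem_heavyBlocks]
    refine ⟨hik, hi.imp (fun ⟨v, hv⟩ => ⟨v, hsub _ hv fun h => hblk ⟨v, by rw [← h]⟩⟩) (fun hle => hle.trans ?_)⟩
    refine Finset.card_le_card fun v hv => ?_
    rw [Finset.mem_filter] at hv ⊢
    exact ⟨hv.1, hsub _ hv.2 fun h => hblk ⟨v, by rw [← h]⟩⟩

/-- **One backward step of the adversary.** If the resolvent `E` of `C ∋ x` and `D ∋ ¬x` has an adversary state and fewer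
than `t` heavy blocks, then `C` or `D` has an adversary state (the adversary answers the query `x`; when an unfixed block is
about to become heavy it first fixes a good vertex for it, which the room condition provides). -/
theorem advInv_step {k M t : ℕ} {δ : ℚ} (hδ : 0 < δ) (hδ1 : δ ≤ 1) (hM : 1 ≤ M)
    (hdense : ∀ A B : Finset (Fin m), M ≤ A.card → M ≤ B.card → δ ≤ H.edgeDensity A B)
    (hroom : ((k + 2 ^ t + 2) * M : ℚ) ≤ δ ^ t * m / 2)
    {C D E : Finset (Literal ℕ)} {x : ℕ} (hQE : (heavyBlocks m k M E).card < t)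
    (hres : IsResolvent C D x E) {U : Finset (ℕ × Fin m)} (hU : AdvInv H k M δ U E) :
    (∃ U', AdvInv H k M δ U' C) ∨ (∃ U', AdvInv H k M δ U' D) := by
  classical
  obtain ⟨hxC, hxD, hE⟩ := hres
  obtain ⟨hcore, himg, hpos, hpin⟩ := hU
  have hCE : ∀ l ∈ C, l ≠ (x, true) → l ∈ E := fun l hl hne =>
    hE ▸ Finset.mem_union_left _ (Finset.mem_erase.2 ⟨hne, hl⟩)
  have hDE : ∀ l ∈ D, l ≠ (x, false) → l ∈ E := fun l hl hne =>
    hE ▸ Finset.mem_union_right _ (Finset.mem_erase.2 ⟨hne, hl⟩)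
  -- the generic "no new block" transfer to `C`
  have toC : (∀ q ∈ U, q.1 ∈ heavyBlocks m k M C → (q.1 * m + q.2.val, true) ≠ (x, true)) →
      heavyBlocks m k M C ⊆ U.image Prod.fst → ∃ U', AdvInv H k M δ U' C := by
    intro hq hheavy
    refine ⟨_, advInv_of_core H hcore hheavy (fun q hqU hqC hmem => ?_) (fun q hqU _ v hv => ?_)⟩
    · exact hpos q hqU (hCE _ hmem (hq q hqU hqC))
    · exact hpin q hqU v (hCE _ hv (by simp))
  by_cases hblk : ∃ i < k, ∃ v : Fin m, x = i * m + v.val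
  swap
  · -- `x` is not a block variable: answer 0, go to `C`
    have hfilter : ((Finset.range k).filter fun i => ∃ v : Fin m, ((x, true) : Literal ℕ).1 = i * m + v.val) = ∅ := by
      rw [Finset.filter_eq_empty_iff]
      intro i hi ⟨v, hv⟩
      exact hblk ⟨i, Finset.mem_range.1 hi, v, hv⟩
    refine Or.inl (toC (fun q hqU hqC heq => hblk ⟨q.1, ?_, q.2, ?_⟩) ?_)
    · have := himg ▸ Finset.mem_image_of_mem Prod.fst hqU
      exact (mem_heavyBlocks.1 (hqC)).1
    · exact (Prod.mk.inj heq).1.symm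
    · have := heavyBlocks_subset_of_forall_mem (m := m) (k := k) (M := M) hCE
      rw [hfilter, Finset.union_empty] at this
      exact himg ▸ this
  obtain ⟨i, hik, v, rfl⟩ := hblk
  -- the filter of blocks of `x` is `{i}`
  have hfilterC : heavyBlocks m k M C ⊆ heavyBlocks m k M E ∪ {i} := by
    refine (heavyBlocks_subset_of_forall_mem (l₀ := (i * m + v.val, true)) hCE).trans ?_
    refine Finset.union_subset_union le_rfl fun j hj => ?_
    rw [Finset.mem_filter] at hj
    obtain ⟨w, hw⟩ := hj.2
    rw [Finset.mem_singleton]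
    exact (blockVar_inj hw).1.symm
  have hfilterD : heavyBlocks m k M D ⊆ heavyBlocks m k M E ∪ {i} := by
    refine (heavyBlocks_subset_of_forall_mem (l₀ := (i * m + v.val, false)) hDE).trans ?_
    refine Finset.union_subset_union le_rfl fun j hj => ?_
    rw [Finset.mem_filter] at hj
    obtain ⟨w, hw⟩ := hj.2
    rw [Finset.mem_singleton]
    exact (blockVar_inj hw).1.symm
  by_cases hfix : i ∈ U.image Prod.fst
  · -- block `i` is fixed to `p.2`
    obtain ⟨p, hp, hp1⟩ := Finset.mem_image.1 hfix
    have hsubE : heavyBlocks m k M E ∪ {i} ⊆ U.image Prod.fst := by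
      refine Finset.union_subset (himg ▸ le_rfl) ?_
      rw [Finset.singleton_subset_iff]
      exact hfix
    by_cases hv : v = p.2
    · -- answer 1: go to `D`
      right
      refine ⟨_, advInv_of_core H hcore (hfilterD.trans hsubE) (fun q hqU _ hmem => ?_) (fun q hqU _ w hw => ?_)⟩
      · exact hpos q hqU (hDE _ hmem (by simp))
      · by_cases heq : ((q.1 * m + w.val, false) : Literal ℕ) = (i * m + v.val, false)
        · obtain ⟨h1, h2⟩ := blockVar_inj (Prod.mk.inj heq).1
          have hqp : q = p := hcore.func q hqU p hp (h1.trans hp1.symm)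
          rw [hqp, ← hv, h2]
        · exact hpin q hqU w (hDE _ hw heq)
    · -- answer 0: go to `C`
      refine Or.inl (toC (fun q hqU _ heq => ?_) (hfilterC.trans hsubE))
      obtain ⟨h1, h2⟩ := blockVar_inj (Prod.mk.inj heq).1
      have hqp : q = p := hcore.func q hqU p hp (h1.trans hp1.symm)
      exact hv (h2.symm.trans (by rw [hqp]))
  · -- block `i` is not fixed (not heavy in `E`)
    by_cases hiC : i ∈ heavyBlocks m k M C
    swap
    · -- still not heavy in `C`: answer 0, go to `C`
      refine Or.inl (toC (fun q hqU hqC heq => ?_) fun j hj => ?_)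
      · obtain ⟨h1, -⟩ := blockVar_inj (Prod.mk.inj heq).1
        exact hiC (h1 ▸ hqC)
      · rcases Finset.mem_union.1 (hfilterC hj) with h | h
        · exact himg ▸ h
        · rw [Finset.mem_singleton] at h
          exact absurd (h ▸ hj) hiC
    · -- block `i` becomes heavy: FIX a good vertex first
      have hiE : i ∉ heavyBlocks m k M E := himg ▸ hfix
      set X : Finset (Fin m) := Finset.univ.filter fun w => (i * m + w.val, true) ∈ C with hX
      have hXcard : X.card ≤ M := by
        have hsub : X ⊆ insert v (Finset.univ.filter fun w : Fin m => (i * m + w.val, true) ∈ E) := by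
          intro w hw
          rw [hX, Finset.mem_filter] at hw
          rw [Finset.mem_insert, Finset.mem_filter]
          by_cases hwv : w = v
          · exact Or.inl hwv
          · refine Or.inr ⟨Finset.mem_univ _, hCE _ hw.2 fun h => hwv ?_⟩
            exact (blockVar_inj (Prod.mk.inj h).1).2
        have hlt : (Finset.univ.filter fun w : Fin m => (i * m + w.val, true) ∈ E).card < M := by
          by_contra hge
          push Not at hge
          exact hiE (mem_heavyBlocks.2 ⟨hik, Or.inr hge⟩)
        have := (Finset.card_le_card hsub).trans (Finset.card_insert_le _ _)
        omega
      have hUt : U.card + 1 ≤ t := by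
        rw [← card_image_fst_of_functional hcore.func, himg]
        exact hQE
      obtain ⟨u, hu, huX, hgood⟩ := exists_good_vertex H k M δ hcore hUt X hXcard hδ hδ1 hM hdense hroom
      have hcore' := advCore_insert H δ hcore hδ.le hfix hu hgood
      left
      refine ⟨_, advInv_of_core H hcore' (fun j hj => ?_) (fun q hqU hqC hmem => ?_) (fun q hqU hqC w hw => ?_)⟩
      · rw [Finset.image_insert]
        rcases Finset.mem_union.1 (hfilterC hj) with h | h
        · exact Finset.mem_insert_of_mem (himg ▸ h)
        · rw [Finset.mem_singleton] at h
          rw [h]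
          exact Finset.mem_insert_self _ _
      · rcases Finset.mem_insert.1 hqU with rfl | hqU
        · apply huX
          rw [hX, Finset.mem_filter]
          exact ⟨Finset.mem_univ _, hmem⟩
        · refine hpos q hqU (hCE _ hmem fun heq => ?_)
          obtain ⟨h1, -⟩ := blockVar_inj (Prod.mk.inj heq).1
          exact hfix (h1 ▸ Finset.mem_image_of_mem Prod.fst hqU)
      · rcases Finset.mem_insert.1 hqU with rfl | hqU
        · exfalso
          apply hiE
          exact mem_heavyBlocks.2 ⟨hik, Or.inl ⟨w, hCE _ hw (by simp)⟩⟩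
        · exact hpin q hqU w (hCE _ hw (by simp))

/-! ## The theorem -/

/-- **Heavy-block width (LPRT Lemma 13 in unary).** If `H` on `m` vertices is one-sidedly `δ`-dense (`0 < δ ≤ 1`) between
all pairs of `M`-sets and there is room for `t` fixings, `(k + 2^t + 2)·M ≤ δ^t·m/2`, then every resolution refutation of
`Clique(H, k)` contains a clause with at least `t` heavy blocks. -/
theorem heavyBlockWidth :
    ∀ (m k M t : ℕ) (δ : ℚ) (H : SimpleGraph (Fin m)) [DecidableRel H.Adj],
      0 < δ → δ ≤ 1 → 1 ≤ M →
      (∀ A B : Finset (Fin m), M ≤ A.card → M ≤ B.card → δ ≤ H.edgeDensity A B) →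
      ((k + 2 ^ t + 2) * M : ℚ) ≤ δ ^ t * m / 2 →
      ∀ π : List (ResLine ℕ), IsResRefutation (cliqueCNF m k fun u v => decide (H.Adj u v)) π →
        ∃ l ∈ π, t ≤ (heavyBlocks m k M l.clause).card := by
  intro m k M t δ H _ hδ hδ1 hM hdense hroom π hπ
  classical
  by_contra hall
  push Not at hall
  have hMm : M ≤ m := by
    have h1 : δ ^ t * (m : ℚ) / 2 ≤ m := by
      have : δ ^ t ≤ 1 := pow_le_one₀ hδ.le hδ1
      have hm0 : (0 : ℚ) ≤ m := Nat.cast_nonneg m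
      nlinarith
    have h2 : (M : ℚ) ≤ (k + 2 ^ t + 2) * M := by
      have hM0 : (0 : ℚ) ≤ M := Nat.cast_nonneg M
      nlinarith [show (0:ℚ) ≤ (k : ℚ) from Nat.cast_nonneg k, show (1:ℚ) ≤ 2 ^ t from one_le_pow₀ (by norm_num)]
    exact_mod_cast h2.trans (hroom.trans h1)
  refine not_isResRefutation_of_safe (fun D => (heavyBlocks m k M D).card < t)
    (fun D => ∃ U, AdvInv H k M δ U D) hall ⟨∅, advInv_empty H k M δ hM⟩ ?_ ?_ ?_ hπ
  · rintro c hc ⟨U, hU⟩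
    exact not_advInv_axiom H hMm hc hU
  · rintro C C' - hsub ⟨U, hcore, himg, hpos, hpin⟩
    exact ⟨_, advInv_of_core H hcore (himg ▸ heavyBlocks_mono hsub) (fun q hq _ h => hpos q hq (hsub h))
      (fun q hq _ w hw => hpin q hq w (hsub hw))⟩
  · rintro C D E x - - hQE hres ⟨U, hU⟩
    exact advInv_step H hδ hδ1 hM hdense hroom hQE hres hU

end Clique

end Summit.PneNP.PneNP.Theorems.RamseyUncertifiableResolutionUncertainty
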